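import Summits.QuantumFields.BalabanUV.Beta.GAN24.AxProjBmWindow

/-!
# `BalabanUV.Beta.GAN24.CoProjBmDivFree` — binder row G-an2-4 / (CONV-C), W-slot CT-route «CT-W» ((W-γ), gan24-p2 g35's `CT-W-SCOPE-v0.md` §2 (F3)), PART 4:
# **THE EXACT DRESSING DEFECT ON A TABLE SLOT** — for EVERY test one-form `g`, `(Πᵀ_bm g)_α(q) − g_α(q) = Σ'_p φ_{α,q}(p) · (div g)(p)` with
# `φ_{α,q} = bmGaugeAt ρ δ_{(α,q)} N` the block-local gauge potential of the leg's bond indicator and `div g (p) = Σ_β (g_β(p) − g_β(p − e_β))`; HENCE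
# **`Πᵀ_bm` FIXES EVERY DIVERGENCE-FREE (WARD-TRANSVERSAL) SLOT**, `div g = 0 ⇒ coProjBmAt ρ N g = g` — the located repair of PART 3's negative: the dressing
# moved onto a table slot (PART 3's memo §3, `D = Πᵀ_bm` slot-wise) is invisible exactly on transversal slots, and its defect is the pairing of the slot's
# DIVERGENCE (the Ward contact term) with a block-supported potential.

NOT IN PRINT; OUR BOOKKEEPING (G-an2-4 crux team (2), leaf prover `b2b-balaban-gan24-formalise-leaf-02`, gen 51; journal [LEAF02-G51-INTENT1]; memo
`HOME/b2b-balaban-gan24-formalise-leaf-02/g51/ctw/CT-W-F3i-LOCATED-v1.md` §3).  PRIOR ART BY NAME: the locality of `Π_bm` and «`Π_bm` does not fix constants»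
are gan24-p4 g27∕g28's `GAN24/AxProjBmWindow` (`treeGaugeAt_eq_zero_of_local`, `blockMeanAt_treeGaugeAt_eq_zero_of_local`, `axProjBmAt_eq_coProjBmW'`) ∕
`GAN24/PiBmConstants` (the row owner's RULINGS-16 (R16-1); re-located for the W-slot by leaf-06 g42's PRE-READ P-leaf06g42-1) — used here BY NAME; what is new is the
DIVERGENCE form of the slot defect.  HONEST FRAMING (cell contract, verbatim): «discharging `BetaPertH` makes Bałaban's
UV stability UNCONDITIONAL — a real constructive-QFT result; it is NOT the continuum limit and NOT the Clay problem.»  HONEST DEPENDENCY (verbatim): «continuum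
YM on T⁴ ⇐ BetaPertH ∧ nine spine estimates (0/9 proved); BetaPertH ⇐ (D1) ∧ (D4) ∧ CAP+tail; G-an2-4 gates asym, D1 and NE2/3/4.»  [folklore] lattice bookkeeping
over an2's `AxialProjectorBlockMean.bmGaugeAt` ∕ `AxialDressingRooted.pmBm` ∕ `coProjBmAt` ∕ `cube` and gan24-p4's `AxProjBmWindow` locality lemmas, all BY NAME; generic dimension
`n`, in-block root, `1 ≤ N`; NO decay or summability hypothesis on `g` (the potential is finitely supported); 0 `def`, 0 cited facts, 0 `def … : Prop`, 0 sorry.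
NO estimate of Bałaban's; discharges NOTHING of (hW, hWall) — it names the exact term the CT-W design must control (the slot divergences of the tower's tables
= their Ward contact terms); 0 wall binders; NEVER «G-an2-4 closed» as (CONV-C); NOT D1, NOT BetaPertH, NOT continuum, NOT Clay.

## What (`ρ = toSite r`, `r ∈ box n N`, `1 ≤ N`; `φ := bmGaugeAt ρ (fun κ z ↦ (bondInd α q κ z : ℝ)) N`)
* §1 `pmBm_eq_bondInd_sub`: `pmBm ρ N β p α q = δ_{(α,q)}(β,p) − (φ(p + e_β) − φ p)` (definitions); **`bmGaugeAt_bondInd_eq_zero_of_blk_ne`**: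
  `φ p = 0` off the block of `q` (`AxProjBmWindow.treeGaugeAt_eq_zero_of_local` ∕ `blockMeanAt_treeGaugeAt_eq_zero_of_local`); `sub_mem_cube_of_bmGaugeAt_ne_zero` ∕
  `sub_mem_cube_of_bmGaugeAt_succ_ne_zero` (the support, and its `e_β`-translate, sit in the window `q + cube`).
* §2 **`coProjBmAt_eq_self_sub_window`**: `(Πᵀ_bm g)_α(q) = g_α(q) − Σ_{v ∈ cube} Σ_β (φ(q+v+e_β) − φ(q+v)) · g_β(q+v)`;
  **`coProjBmAt_eq_self_sub_tsum_div`**: `(Πᵀ_bm g)_α(q) = g_α(q) − Σ'_p φ p · Σ_β (g_β(p − e_β) − g_β p)` i.e. `= g_α(q) + Σ'_p φ p · (div g)(p)` (summation by parts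
  against the finitely supported `φ`).
* §3 **`coProjBmAt_eq_self_of_divFree`**: `(∀ p, Σ_β (g β p − g β (p − e_β)) = 0) → coProjBmAt ρ N g = g`; corollary `coProjBmAt_constForm'` = the owner's
  `SrecChargeBm.coProjBmAt_const` RE-DERIVED (constants are divergence-free) — consistency check of the sign conventions.
* §4 **`coProjBmAtK_eq_self_of_divFree`**: the same for an2's `MKer`-valued bond slot `coProjBmAtK` (the slot of `dressBmAt`): Ward-transversal stencil
  families are FIXED by the block-mean bond-slot dressing.
-/

noncomputable section

open Finset
open scoped BigOperators
open Literature.MathematicalPhysics.QuantumFieldTheory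
open Literature.MathematicalPhysics.QuantumFieldTheory.Balaban1983to89
open Literature.MathematicalPhysics.QuantumFieldTheory.Balaban1983to89.Beta
open AffineAveraging (Form0 Form1 box toSite unitVec unitVec_apply)
open AveragingContours (grad blk)
open AveragingContoursRooted (treeGaugeAt)
open AxialProjector (zsmul_blk_le lt_zsmul_blk_add)
open Summit.QuantumFields.BalabanUV.Beta.AxialProjectorBlockMean (blockMeanAt bmGaugeAt axProjBmAt)
open Summit.QuantumFields.BalabanUV.Beta.AxialDressingRooted (bondInd bondInd_apply pmBm cube mem_cube zero_mem_cube coProjBmAt coProjBmAt_apply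
  coProjBmAtK coProjBmAtK_eval)
open Summit.QuantumFields.BalabanUV.Beta.GAN24.AxProjBmWindow (treeGaugeAt_eq_zero_of_local blockMeanAt_treeGaugeAt_eq_zero_of_local)

namespace Summit.QuantumFields.BalabanUV.Beta.GAN24.CoProjBmDivFree

variable {n d : ℕ}

/-! ## §1 The projector matrix as `δ − grad φ`; the support of the potential `φ` -/

/-- [folklore] `pmBm ρ N β p α q = δ_{(α,q)}(β,p) − (φ(p + e_β) − φ(p))`, `φ = bmGaugeAt ρ δ_{(α,q)} N` (the definitions of `pmBm` ∕ `axProjBmAt`). -/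
theorem pmBm_eq_bondInd_sub (ρ : Fin n → ℤ) (N : ℕ) (β : Fin n) (p : Fin n → ℤ) (α : Fin n) (q : Fin n → ℤ) :
    pmBm ρ N β p α q = (bondInd α q β p : ℝ)
      - (bmGaugeAt ρ (fun κ z => (bondInd α q κ z : ℝ)) N (p + unitVec β) - bmGaugeAt ρ (fun κ z => (bondInd α q κ z : ℝ)) N p) := by
  simp only [pmBm, axProjBmAt, grad, Pi.sub_apply]

/-- [folklore] **THE GAUGE POTENTIAL OF A BOND INDICATOR IS SUPPORTED IN THE BOND'S BLOCK**: `bmGaugeAt ρ δ_{(α,q)} N p = 0` whenever `blk N p ≠ blk N q`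
(in-block root; the rooted tree gauge at `p` and its block mean only integrate over the block of `p`, where `δ_{(α,q)}` vanishes — gan24-p4's
`AxProjBmWindow.treeGaugeAt_eq_zero_of_local` ∕ `blockMeanAt_treeGaugeAt_eq_zero_of_local`). -/
theorem bmGaugeAt_bondInd_eq_zero_of_blk_ne {N : ℕ} (hN : 1 ≤ N) {r : Fin (d + 1) → ℕ} (hr : r ∈ box (d + 1) N) (α : Fin (d + 1)) (q : Fin (d + 1) → ℤ)
    {p : Fin (d + 1) → ℤ} (h : blk N p ≠ blk N q) : bmGaugeAt (toSite r) (fun κ z => (bondInd α q κ z : ℝ)) N p = 0 := by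
  have hvan : ∀ (κ : Fin (d + 1)) (w : Fin (d + 1) → ℤ), blk N w = blk N p → (bondInd α q κ w : ℝ) = 0 := by
    intro κ w hw
    rw [bondInd_apply]
    split_ifs with hκw
    · exact absurd (hw.symm.trans (by rw [hκw.2])) h
    · simp
  simp only [bmGaugeAt, Pi.sub_apply]
  rw [treeGaugeAt_eq_zero_of_local hN hr hvan, blockMeanAt_treeGaugeAt_eq_zero_of_local hN hr hvan, sub_zero]

/-- [folklore] Two points of one block differ by less than `N` in every coordinate. -/
theorem abs_sub_le_of_blk_eq {N : ℕ} (hN : 1 ≤ N) {p q : Fin n → ℤ} (h : blk N p = blk N q) (i : Fin n) : |p i - q i| ≤ (N : ℤ) - 1 := by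
  have a1 := zsmul_blk_le hN p i
  have a2 := lt_zsmul_blk_add hN p i
  have b1 := zsmul_blk_le hN q i
  have b2 := lt_zsmul_blk_add hN q i
  simp only [Pi.smul_apply, smul_eq_mul] at a1 a2 b1 b2
  rw [h] at a1 a2
  rw [abs_le]
  constructor <;> omega

/-- [folklore] The support of `φ_{α,q}` lies in the window: `φ p ≠ 0 ⇒ p − q ∈ cube (d + 1) N`. -/
theorem sub_mem_cube_of_bmGaugeAt_ne_zero {N : ℕ} (hN : 1 ≤ N) {r : Fin (d + 1) → ℕ} (hr : r ∈ box (d + 1) N) (α : Fin (d + 1)) (q : Fin (d + 1) → ℤ)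
    {p : Fin (d + 1) → ℤ} (h : bmGaugeAt (toSite r) (fun κ z => (bondInd α q κ z : ℝ)) N p ≠ 0) : p - q ∈ cube (d + 1) N := by
  have hblk : blk N p = blk N q := by
    by_contra hne
    exact h (bmGaugeAt_bondInd_eq_zero_of_blk_ne hN hr α q hne)
  rw [mem_cube]
  intro i
  have := abs_sub_le_of_blk_eq hN hblk i
  rw [Pi.sub_apply]
  omega

/-- [folklore] … and so does its `e_β`-translate: `φ (p + e_β) ≠ 0 ⇒ p − q ∈ cube (d + 1) N`. -/
theorem sub_mem_cube_of_bmGaugeAt_succ_ne_zero {N : ℕ} (hN : 1 ≤ N) {r : Fin (d + 1) → ℕ} (hr : r ∈ box (d + 1) N) (α : Fin (d + 1)) (q : Fin (d + 1) → ℤ)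
    (β : Fin (d + 1)) {p : Fin (d + 1) → ℤ} (h : bmGaugeAt (toSite r) (fun κ z => (bondInd α q κ z : ℝ)) N (p + unitVec β) ≠ 0) :
    p - q ∈ cube (d + 1) N := by
  have hblk : blk N (p + unitVec β) = blk N q := by
    by_contra hne
    exact h (bmGaugeAt_bondInd_eq_zero_of_blk_ne hN hr α q hne)
  rw [mem_cube]
  intro i
  have h1 := abs_sub_le_of_blk_eq hN hblk i
  rw [Pi.add_apply, unitVec_apply] at h1
  rw [Pi.sub_apply, abs_le]
  have := abs_le.1 h1
  split_ifs at this <;> constructor <;> omega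

/-! ## §2 `Πᵀ_bm g = g − (pairing of grad φ with g) = g + Σ' φ · div g` -/

/-- NOT IN PRINT; OUR BOOKKEEPING.  **`Πᵀ_bm` AS IDENTITY MINUS A WINDOW PAIRING**: for every test form `g`,
`coProjBmAt ρ N g α q = g α q − Σ_{v ∈ cube} Σ_β (φ(q+v+e_β) − φ(q+v)) · g β (q+v)`, `φ = bmGaugeAt ρ δ_{(α,q)} N`. -/
theorem coProjBmAt_eq_self_sub_window (ρ : Fin (d + 1) → ℤ) (N : ℕ) (g : Form1 (d + 1) ℝ) (α : Fin (d + 1)) (q : Fin (d + 1) → ℤ) :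
    coProjBmAt ρ N g α q = g α q - ∑ v ∈ cube (d + 1) N, ∑ β : Fin (d + 1),
      (bmGaugeAt ρ (fun κ z => (bondInd α q κ z : ℝ)) N (q + v + unitVec β) - bmGaugeAt ρ (fun κ z => (bondInd α q κ z : ℝ)) N (q + v)) * g β (q + v) := by
  rw [coProjBmAt_apply]
  simp_rw [pmBm_eq_bondInd_sub, sub_mul, Finset.sum_sub_distrib]
  congr 1
  -- the δ part picks `v = 0`, `β = α`
  simp only [bondInd_apply]
  have e : ∀ v ∈ cube (d + 1) N, ∑ β : Fin (d + 1), ((if β = α ∧ q + v = q then (1 : ℤ) else 0 : ℤ) : ℝ) * g β (q + v)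
      = if v = 0 then g α q else 0 := by
    intro v _
    by_cases hv : v = 0
    · subst hv
      simp only [add_zero, and_true, if_true]
      rw [Finset.sum_eq_single α]
      · simp
      · intro β _ hβ; simp [hβ]
      · intro h; exact absurd (Finset.mem_univ α) h
    · rw [if_neg hv]
      refine Finset.sum_eq_zero fun β _ => ?_
      have : ¬ (β = α ∧ q + v = q) := fun h => hv (by simpa using h.2)
      rw [if_neg this]; simp
  rw [Finset.sum_congr rfl e, Finset.sum_ite_eq' (cube (d + 1) N) (0 : Fin (d + 1) → ℤ) (fun _ => g α q), if_pos (zero_mem_cube N)]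

/-- NOT IN PRINT; OUR BOOKKEEPING.  **SUMMATION BY PARTS AGAINST THE BLOCK-SUPPORTED POTENTIAL** (in-block root, `1 ≤ N`, ANY `g`):
`coProjBmAt ρ N g α q = g α q − Σ'_p φ p · Σ_β (g β (p − e_β) − g β p)` — i.e. `(Πᵀ_bm g − g)_α(q) = Σ'_p φ_{α,q}(p) · (div g)(p)`,
`div g (p) = Σ_β (g β p − g β (p − e_β))`: THE DRESSING DEFECT ON A SLOT IS THE PAIRING OF THE SLOT'S DIVERGENCE WITH A BLOCK-SUPPORTED POTENTIAL. -/
theorem coProjBmAt_eq_self_sub_tsum_div {N : ℕ} (hN : 1 ≤ N) {r : Fin (d + 1) → ℕ} (hr : r ∈ box (d + 1) N) (g : Form1 (d + 1) ℝ) (α : Fin (d + 1)) (q : Fin (d + 1) → ℤ) :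
    coProjBmAt (toSite r) N g α q = g α q
      - ∑' p : Fin (d + 1) → ℤ, bmGaugeAt (toSite r) (fun κ z => (bondInd α q κ z : ℝ)) N p * ∑ β : Fin (d + 1), (g β (p - unitVec β) - g β p) := by
  set φ : Form0 (d + 1) ℝ := bmGaugeAt (toSite r) (fun κ z => (bondInd α q κ z : ℝ)) N with hφ
  rw [coProjBmAt_eq_self_sub_window]
  congr 1
  -- the window as a finset of points
  set W : Finset (Fin (d + 1) → ℤ) := (cube (d + 1) N).map (addLeftEmbedding q) with hW
  have hWmem : ∀ {p : Fin (d + 1) → ℤ}, p - q ∈ cube (d + 1) N → p ∈ W := by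
    intro p hp
    rw [hW, Finset.mem_map]
    exact ⟨p - q, hp, by simp [addLeftEmbedding]⟩
  -- supports
  have hs1 : ∀ (β : Fin (d + 1)) (p : Fin (d + 1) → ℤ), p ∉ W → φ (p + unitVec β) * g β p = 0 := by
    intro β p hp
    by_cases h : φ (p + unitVec β) = 0
    · rw [h, zero_mul]
    · exact absurd (hWmem (sub_mem_cube_of_bmGaugeAt_succ_ne_zero hN hr α q β h)) hp
  have hs2 : ∀ (β : Fin (d + 1)) (p : Fin (d + 1) → ℤ), p ∉ W → φ p * g β p = 0 := by
    intro β p hp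
    by_cases h : φ p = 0
    · rw [h, zero_mul]
    · exact absurd (hWmem (sub_mem_cube_of_bmGaugeAt_ne_zero hN hr α q h)) hp
  have hs3 : ∀ (β : Fin (d + 1)) (p : Fin (d + 1) → ℤ), p ∉ W → φ p * g β (p - unitVec β) = 0 := by
    intro β p hp
    by_cases h : φ p = 0
    · rw [h, zero_mul]
    · exact absurd (hWmem (sub_mem_cube_of_bmGaugeAt_ne_zero hN hr α q h)) hp
  -- LHS: the window double sum as a sum over `W`, then as `tsum`s
  have eL : ∑ v ∈ cube (d + 1) N, ∑ β : Fin (d + 1), (φ (q + v + unitVec β) - φ (q + v)) * g β (q + v)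
      = ∑ β : Fin (d + 1), ((∑' p : Fin (d + 1) → ℤ, φ (p + unitVec β) * g β p) - ∑' p : Fin (d + 1) → ℤ, φ p * g β p) := by
    rw [Finset.sum_comm]
    refine Finset.sum_congr rfl fun β _ => ?_
    have e1 : ∑ v ∈ cube (d + 1) N, (φ (q + v + unitVec β) - φ (q + v)) * g β (q + v)
        = ∑ p ∈ W, (φ (p + unitVec β) - φ p) * g β p := by
      rw [hW, Finset.sum_map]
      rfl
    rw [e1, tsum_eq_sum (s := W) (fun p hp => hs1 β p hp), tsum_eq_sum (s := W) (fun p hp => hs2 β p hp), ← Finset.sum_sub_distrib]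
    exact Finset.sum_congr rfl fun p _ => by ring
  -- shift the first `tsum`: `Σ' φ(p+e_β) g β p = Σ' φ p g β (p − e_β)`
  have eS : ∀ β : Fin (d + 1), ∑' p : Fin (d + 1) → ℤ, φ (p + unitVec β) * g β p = ∑' p : Fin (d + 1) → ℤ, φ p * g β (p - unitVec β) := by
    intro β
    have h := (Equiv.addRight (unitVec β)).tsum_eq (fun p : Fin (d + 1) → ℤ => φ p * g β (p - unitVec β))
    simp only [Equiv.coe_addRight, add_sub_cancel_right] at h
    exact h
  -- RHS: pull the finite `β`-sum inside the `tsum`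
  have eR : ∑' p : Fin (d + 1) → ℤ, φ p * ∑ β : Fin (d + 1), (g β (p - unitVec β) - g β p)
      = ∑ β : Fin (d + 1), ((∑' p : Fin (d + 1) → ℤ, φ p * g β (p - unitVec β)) - ∑' p : Fin (d + 1) → ℤ, φ p * g β p) := by
    have hsum3 : ∀ β : Fin (d + 1), Summable fun p : Fin (d + 1) → ℤ => φ p * g β (p - unitVec β) :=
      fun β => summable_of_ne_finset_zero (s := W) (fun p hp => hs3 β p hp)
    have hsum2 : ∀ β : Fin (d + 1), Summable fun p : Fin (d + 1) → ℤ => φ p * g β p :=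
      fun β => summable_of_ne_finset_zero (s := W) (fun p hp => hs2 β p hp)
    have e1 : (fun p : Fin (d + 1) → ℤ => φ p * ∑ β : Fin (d + 1), (g β (p - unitVec β) - g β p))
        = fun p => ∑ β : Fin (d + 1), (φ p * g β (p - unitVec β) - φ p * g β p) := by
      funext p
      rw [Finset.mul_sum]
      exact Finset.sum_congr rfl fun β _ => by ring
    rw [e1, Summable.tsum_finsetSum (fun β _ => (hsum3 β).sub (hsum2 β))]
    exact Finset.sum_congr rfl fun β _ => (hsum3 β).tsum_sub (hsum2 β)
  rw [eL, eR]
  exact Finset.sum_congr rfl fun β _ => by rw [eS β]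

/-! ## §3 Divergence-free slots are fixed -/

/-- NOT IN PRINT; OUR BOOKKEEPING.  **`Πᵀ_bm` FIXES EVERY DIVERGENCE-FREE TEST FORM** (in-block root, `1 ≤ N`; NO decay hypothesis): if
`Σ_β (g β p − g β (p − e_β)) = 0` at every site (the slot annihilates all finitely supported gradients — WARD TRANSVERSALITY), then `coProjBmAt ρ N g = g`.
So the table dressing `D = Πᵀ_bm` of PART 3's memo is INVISIBLE on transversal slots; on a general slot its defect is `Σ' φ · div g` (§2). -/
theorem coProjBmAt_eq_self_of_divFree {N : ℕ} (hN : 1 ≤ N) {r : Fin (d + 1) → ℕ} (hr : r ∈ box (d + 1) N) {g : Form1 (d + 1) ℝ}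
    (hdiv : ∀ p : Fin (d + 1) → ℤ, ∑ β : Fin (d + 1), (g β p - g β (p - unitVec β)) = 0) : coProjBmAt (toSite r) N g = g := by
  funext α q
  rw [coProjBmAt_eq_self_sub_tsum_div hN hr]
  have e : ∀ p : Fin (d + 1) → ℤ, ∑ β : Fin (d + 1), (g β (p - unitVec β) - g β p) = 0 := by
    intro p
    have h := hdiv p
    rw [← neg_eq_zero, ← Finset.sum_neg_distrib] at h
    simpa only [neg_sub] using h
  simp only [e, mul_zero, tsum_zero, sub_zero]

/-- [folklore] COROLLARY = the owner's `SrecChargeBm.coProjBmAt_const` RE-DERIVED: the constant form is divergence-free, hence fixed by `Πᵀ_bm`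
(consistency check of the conventions; CONTRAST PART 1 `axProjBmAt_constForm_ne_self`: `Π_bm` itself does NOT fix it). -/
theorem coProjBmAt_constForm' {N : ℕ} (hN : 1 ≤ N) {r : Fin (d + 1) → ℕ} (hr : r ∈ box (d + 1) N) (c : Fin (d + 1) → ℝ) :
    coProjBmAt (toSite r) N (fun β _ => c β) = fun β _ => c β :=
  coProjBmAt_eq_self_of_divFree hN hr fun p => by simp


/-! ## §4 The same on `MKer`-valued stencil slots (`coProjBmAtK`, the bond slot of an2's `dressBmAt`) -/

/-- NOT IN PRINT; OUR BOOKKEEPING.  **THE BLOCK-MEAN BOND-SLOT DRESSING IS INVISIBLE ON WARD-TRANSVERSAL STENCIL FAMILIES**: if every kernel entry of the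
family is divergence-free in the bond slot, `Σ_β (S β p x y a b − S β (p − e_β) x y a b) = 0`, then `coProjBmAtK ρ N S = S` (entrywise §3). -/
theorem coProjBmAtK_eq_self_of_divFree {N : ℕ} (hN : 1 ≤ N) {r : Fin (d + 1) → ℕ} (hr : r ∈ box (d + 1) N)
    {S : Fin (d + 1) → (Fin (d + 1) → ℤ) → ExpKernelCalculus.MKer (d + 1) (OneStepResolventKernel.Fib d)}
    (hdiv : ∀ (p x y : Fin (d + 1) → ℤ) (a b : OneStepResolventKernel.Fib d), ∑ β : Fin (d + 1), (S β p x y a b - S β (p - unitVec β) x y a b) = 0) :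
    coProjBmAtK (toSite r) N S = S := by
  funext κ u x y a b
  rw [coProjBmAtK_eval, coProjBmAt_eq_self_of_divFree hN hr (g := fun κ' u' => S κ' u' x y a b) (fun p => hdiv p x y a b)]

end Summit.QuantumFields.BalabanUV.Beta.GAN24.CoProjBmDivFree

end
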